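import Summits.HodgeConjecture.HodgeConjecture.Theorems.WeilTypeLadderOnPath
import Literature.AlgebraicGeometry.HodgeTheory.WeilClassesCyclicPrymDegreeSeven
import Literature.AlgebraicGeometry.HodgeTheory.WeilClassesMoonenZarhinCriterion
import HarnessLib

/-!
# WeilTypeLadder · the rung R3 (`WeilClassesCMField`) on Schoen's cyclic Prym locus of degree `7` (K = ℚ(ζ₇), `[K:ℚ] = 6`)

b2b cell `hweil` (packet `run/shared/lean/b2b/hodge-weil/`, CENSUS.md ## P3-g2). The ladder rung
`WeilTypeLadder.WeilClassesCMField` (R3: Weil classes `W_K = ⋀^{2m}_K H¹(A,ℚ)` for a CM field `K`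
with `[K:ℚ] = e > 2`) is OPEN for the general member ("as well as for CM-fields `K` with `[K:ℚ]>2`",
Markman, arXiv:2509.23403 §12). It is NOT open on Schoen's cyclic Prym loci: for an étale cyclic
cover `C → C'` of prime degree `m` of a genus-`q` curve, the Prym `B = (ker Nm)⁰` carries
`K = ℚ(ζ_m)` (degree `m - 1`) with `H¹(B,ℚ)` free of rank `h = 2q - 2` over `K`, and
`U' = ⋀^h_K H¹(B,ℚ)` — the space of Weil classes of `(B, K)` in the sense of Moonen–Zarhin 1998 §1
(`W_K ⊗ ℂ = ⊕_σ ⋀^h H¹_σ`) — "is generated by fundamental classes of codimension `h/2` algebraic cycles"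
(C. Schoen, Compositio Math. 65 (1988), Cor. 3.1 with Thm. 2.0; REFEREED; no genericity hypothesis).
The instance `(q, m) = (7, 7)` (`B` an abelian `36`-fold, `K = ℚ(ζ₇)`, `h = 12`) is typed in the tree
as the named fact `Schoen1988_cyclicPrym_weilClasses_algebraic_degreeSeven` (six eigen-lines of
`(2·𝟙 + s_B)^*` on `H¹²`).

This file proves: (i) on that locus every class of the tree's `weilClassesField B s_B Φ₇ 12`
(`= ⨆_{Φ₇(ρ)=0}` joint eigenclasses of all `(x·𝟙 + y·s_B)^*` with character `(x + yρ)¹²`) is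
algebraic, from the fact — each joint eigenclass space sits in the fact's eigen-line of
`(2·𝟙 + s_B)^*` for `ρ = ζ₇^a` (`pullbackEigenclasses_le_eigenspace_two_add`; the roots of `Φ₇` are
the `ζ₇^a`, `1 ≤ a ≤ 6`, `exists_eq_exp_pow_of_cyclotomic_seven`); (ii) hence the literal body of R3
at `(A, φ, P, e, m) := (B, s_B, Φ₇, 6, 6)` (a CASE of R3 proved modulo [Schoen 1988, Cor. 3.1]; the
rung's arithmetic hypotheses on `P` and the rationality / Hodge-type hypotheses are carried, unused);
(iii) the same body from the rung itself and (iv) from `HodgeConjecture` (on-path).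

HONEST LABEL. An 18-dimensional locus (moduli of `(C', η)`, `g(C') = 7`, `η ∈ J(C')[7]`) — known
since 1988; typed so that the census of R3 is exact: OPEN for the general member, PROVED (mod a
refereed fact) on the cyclic Prym loci. 0 unconditional rungs added. No `sorry`, no definitions, no new facts.
-/

noncomputable section

-- every declaration of this problem lives in `Summit.HodgeConjecture.HodgeConjecture.…` (summit = sub-problem)
set_option linter.dupNamespace false

open CategoryTheory
open Literature.AlgebraicGeometry Literature.AlgebraicGeometry.Motives
open Literature.AlgebraicGeometry.HodgeTheory
open Literature.AlgebraicTopology.SingularHomology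

namespace Summit.HodgeConjecture.HodgeConjecture.WeilTypeLadder

/-- A joint eigenclass of all `(x·𝟙 + y·φ)^*` with character `(x + yρ)ᵏ` is in particular an
eigenclass of `(2·𝟙 + φ)^*` with eigenvalue `(2 + ρ)ᵏ` (`x = 2`, `y = 1`). -/
theorem pullbackEigenclasses_le_eigenspace_two_add (B : AbelianVariety ℂ) (φ : B ⟶ B) (k : ℕ) (ρ : ℂ) :
    pullbackEigenclasses B φ k (fun x y => ((x : ℂ) + (y : ℂ) * ρ) ^ k) ≤
      Module.End.eigenspace (complexBetti.map ((2 : ℤ) • 𝟙 B + φ).hom.hom.hom k).hom ((2 + ρ) ^ k) := by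
  intro c hc
  rw [Module.End.mem_eigenspace_iff]
  have h := (mem_pullbackEigenclasses_iff.mp hc) 2 1
  have hop : ((2 : ℤ) • 𝟙 B + φ : B ⟶ B) = (2 : ℕ) • 𝟙 B + (1 : ℕ) • φ := by
    rw [one_smul, ofNat_zsmul]
  have hval : ((2 : ℂ) + ρ) = ((2 : ℕ) : ℂ) + ((1 : ℕ) : ℂ) * ρ := by push_cast; ring
  rw [hop, hval]
  exact h

/-- The complex roots of `Φ₇ ∈ ℤ[T]` are `ζ₇^a`, `1 ≤ a ≤ 6`, `ζ₇ = exp(2πi/7)`. [folklore] -/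
theorem exists_eq_exp_pow_of_cyclotomic_seven {ρ : ℂ}
    (hρ : Polynomial.eval₂ (Int.castRingHom ℂ) ρ (Polynomial.cyclotomic 7 ℤ) = 0) :
    ∃ a : ℕ, 1 ≤ a ∧ a ≤ 6 ∧ ρ = Complex.exp (2 * (Real.pi : ℂ) * Complex.I / 7) ^ a := by
  have h1 : Polynomial.IsRoot (Polynomial.cyclotomic 7 ℂ) ρ := by
    rw [Polynomial.IsRoot, ← Polynomial.map_cyclotomic_int 7 ℂ, Polynomial.eval_map]
    exact hρ
  have hprim : IsPrimitiveRoot ρ 7 := Polynomial.isRoot_cyclotomic_iff.mp h1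
  have hζ : IsPrimitiveRoot (Complex.exp (2 * (Real.pi : ℂ) * Complex.I / 7)) 7 := by
    simpa using Complex.isPrimitiveRoot_exp 7 (by norm_num)
  obtain ⟨i, hi, heq⟩ := hζ.eq_pow_of_pow_eq_one hprim.pow_eq_one
  refine ⟨i, ?_, by omega, heq.symm⟩
  rcases Nat.eq_zero_or_pos i with rfl | hpos
  · exfalso
    rw [pow_zero] at heq
    exact hprim.ne_one (by norm_num) heq.symm
  · exact hpos

/-- **Schoen's degree-`7` fact in the Moonen–Zarhin vocabulary**: on Schoen's Prym `36`-fold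
`B = (ker(𝟙 + s + ⋯ + s⁶))⁰ ⊂ J(C)` of an étale cyclic cover of degree `7` of a genus-`7` curve
(`g(C) = 43`, `s = σ_*`), with `s_B = s|_B` (`Φ₇(s_B) = 0`, `ℚ(s_B) = ℚ(ζ₇)`), EVERY class of
`weilClassesField B s_B Φ₇ 12 = W_{ℚ(ζ₇)} ⊗ ℂ` is algebraic (codimension `6`). Conditional on the
refereed fact only. [cite: Schoen1988HodgeWeil, Thm 2.0 (p. 11) and Cor 3.1 (p. 24)]
[cite: MoonenZarhin1998WeilClasses, §1] [cite: PatelZhang2025PrymHodge, Thm 1.2 and Thm 5.3] -/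
theorem weilClassesField_le_algebraicClasses_cyclicPrymSeven_of_schoen
    (hS : Schoen1988_cyclicPrym_weilClasses_algebraic_degreeSeven) :
    ∀ (C : SchemeOver ℂ) (𝒥 : Jacobian C) (σ : C ⟶ C),
      IsSmoothProjective 1 C → 𝒥.J.dim = 43 →
      σ ≫ σ ≫ σ ≫ σ ≫ σ ≫ σ ≫ σ = 𝟙 C → (∀ P : ComplexPoints C, P ≫ σ ≠ P) →
    ∀ (s eN : 𝒥.J ⟶ 𝒥.J), s = 𝒥.pushforward 𝒥 σ →
      eN = 𝟙 𝒥.J + s + s ≫ s + s ≫ s ≫ s + s ≫ s ≫ s ≫ s + s ≫ s ≫ s ≫ s ≫ s +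
        s ≫ s ≫ s ≫ s ≫ s ≫ s →
    ∀ (sB : AbelianVariety.kerComponent eN ⟶ AbelianVariety.kerComponent eN),
      sB ≫ AbelianVariety.kerComponentι eN = AbelianVariety.kerComponentι eN ≫ s →
      weilClassesField (AbelianVariety.kerComponent eN) sB (Polynomial.cyclotomic 7 ℤ) 12 ≤
        algebraicClasses (AbelianVariety.kerComponent eN).X 6 := by
  intro C 𝒥 σ hC h43 hσ hfree s eN hs heN sB hsB c hc
  rw [mem_weilClassesField_iff] at hc
  have key : (⨆ ρ ∈ {ρ : ℂ | Polynomial.eval₂ (Int.castRingHom ℂ) ρ (Polynomial.cyclotomic 7 ℤ) = 0},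
      pullbackEigenclasses (AbelianVariety.kerComponent eN) sB 12
        (fun x y => ((x : ℂ) + (y : ℂ) * ρ) ^ 12)) ≤
      algebraicClasses (AbelianVariety.kerComponent eN).X 6 := by
    refine iSup₂_le fun ρ hρ => ?_
    obtain ⟨a, ha1, ha6, rfl⟩ := exists_eq_exp_pow_of_cyclotomic_seven hρ
    intro c' hc'
    exact hS C 𝒥 σ hC h43 hσ hfree s eN hs heN sB hsB a ha1 ha6 c'
      (pullbackEigenclasses_le_eigenspace_two_add _ _ 12 _ hc')
  exact key hc

/-- **R3 on Schoen's cyclic Prym locus of degree `7`, from the refereed fact**: the literal body of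
`WeilClassesCMField` at `(A, φ, P, e, m) := (B, s_B, Φ₇, 6, 6)` (the arithmetic hypotheses on `P`,
`e·(2m) = 2·dim B`, rationality and Hodge type are carried, unused: the fact gives EVERY class of
`W_K ⊗ ℂ`). A CASE of R3 proved modulo [Schoen 1988, Cor. 3.1 with Thm. 2.0 at `(q,m,r) = (7,7,0)`].
[cite: Schoen1988HodgeWeil, Thm 2.0 (p. 11) and Cor 3.1 (p. 24)] [cite: MoonenZarhin1998WeilClasses, §1] -/
theorem weilClassesCMField_cyclicPrymSeven_of_schoen
    (hS : Schoen1988_cyclicPrym_weilClasses_algebraic_degreeSeven) :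
    ∀ (C : SchemeOver ℂ) (𝒥 : Jacobian C) (σ : C ⟶ C),
      IsSmoothProjective 1 C → 𝒥.J.dim = 43 →
      σ ≫ σ ≫ σ ≫ σ ≫ σ ≫ σ ≫ σ = 𝟙 C → (∀ P : ComplexPoints C, P ≫ σ ≠ P) →
    ∀ (s eN : 𝒥.J ⟶ 𝒥.J), s = 𝒥.pushforward 𝒥 σ →
      eN = 𝟙 𝒥.J + s + s ≫ s + s ≫ s ≫ s + s ≫ s ≫ s ≫ s + s ≫ s ≫ s ≫ s ≫ s +
        s ≫ s ≫ s ≫ s ≫ s ≫ s →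
    ∀ (sB : AbelianVariety.kerComponent eN ⟶ AbelianVariety.kerComponent eN),
      sB ≫ AbelianVariety.kerComponentι eN = AbelianVariety.kerComponentι eN ≫ s →
      (Polynomial.cyclotomic 7 ℤ).Monic → (Polynomial.cyclotomic 7 ℤ).natDegree = 6 → 2 < 6 →
      Irreducible ((Polynomial.cyclotomic 7 ℤ).map (Int.castRingHom ℚ)) →
      Polynomial.eval₂ (Int.castRingHom (CategoryTheory.End (AbelianVariety.kerComponent eN)))
        (sB : CategoryTheory.End (AbelianVariety.kerComponent eN)) (Polynomial.cyclotomic 7 ℤ) = 0 →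
      6 * (2 * 6) = 2 * (AbelianVariety.kerComponent eN).dim →
      (∀ ρ : ℂ, Polynomial.eval₂ (Int.castRingHom ℂ) ρ (Polynomial.cyclotomic 7 ℤ) = 0 →
        starRingEnd ℂ ρ ≠ ρ) →
      (∃ Q : Polynomial ℚ, ∀ ρ : ℂ, Polynomial.eval₂ (Int.castRingHom ℂ) ρ (Polynomial.cyclotomic 7 ℤ) = 0 →
          Polynomial.eval₂ (algebraMap ℚ ℂ) ρ Q = starRingEnd ℂ ρ) →
      ∀ c ∈ weilClassesField (AbelianVariety.kerComponent eN) sB (Polynomial.cyclotomic 7 ℤ) (2 * 6),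
        IsRationalClass c →
        IsOfHodgeType (AbelianVariety.kerComponent eN).dim (AbelianVariety.kerComponent eN).X (2 * 6) 6 6 c →
        c ∈ algebraicClasses (AbelianVariety.kerComponent eN).X 6 := by
  intro C 𝒥 σ hC h43 hσ hfree s eN hs heN sB hsB _ _ _ _ _ _ _ _ c hc _ _
  exact weilClassesField_le_algebraicClasses_cyclicPrymSeven_of_schoen hS C 𝒥 σ hC h43 hσ hfree s eN hs
    heN sB hsB hc

/-- **The same body from the rung R3 itself** (Schoen's degree-`7` cyclic-Prym locus is a CASE of
`WeilClassesCMField`, at `P = Φ₇`, `e = m = 6`). -/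
theorem weilClassesCMField_cyclicPrymSeven_of_weilClassesCMField (h : WeilClassesCMField) :
    ∀ (C : SchemeOver ℂ) (𝒥 : Jacobian C) (σ : C ⟶ C),
      IsSmoothProjective 1 C → 𝒥.J.dim = 43 →
      σ ≫ σ ≫ σ ≫ σ ≫ σ ≫ σ ≫ σ = 𝟙 C → (∀ P : ComplexPoints C, P ≫ σ ≠ P) →
    ∀ (s eN : 𝒥.J ⟶ 𝒥.J), s = 𝒥.pushforward 𝒥 σ →
      eN = 𝟙 𝒥.J + s + s ≫ s + s ≫ s ≫ s + s ≫ s ≫ s ≫ s + s ≫ s ≫ s ≫ s ≫ s +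
        s ≫ s ≫ s ≫ s ≫ s ≫ s →
    ∀ (sB : AbelianVariety.kerComponent eN ⟶ AbelianVariety.kerComponent eN),
      sB ≫ AbelianVariety.kerComponentι eN = AbelianVariety.kerComponentι eN ≫ s →
      (Polynomial.cyclotomic 7 ℤ).Monic → (Polynomial.cyclotomic 7 ℤ).natDegree = 6 → 2 < 6 →
      Irreducible ((Polynomial.cyclotomic 7 ℤ).map (Int.castRingHom ℚ)) →
      Polynomial.eval₂ (Int.castRingHom (CategoryTheory.End (AbelianVariety.kerComponent eN)))
        (sB : CategoryTheory.End (AbelianVariety.kerComponent eN)) (Polynomial.cyclotomic 7 ℤ) = 0 →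
      6 * (2 * 6) = 2 * (AbelianVariety.kerComponent eN).dim →
      (∀ ρ : ℂ, Polynomial.eval₂ (Int.castRingHom ℂ) ρ (Polynomial.cyclotomic 7 ℤ) = 0 →
        starRingEnd ℂ ρ ≠ ρ) →
      (∃ Q : Polynomial ℚ, ∀ ρ : ℂ, Polynomial.eval₂ (Int.castRingHom ℂ) ρ (Polynomial.cyclotomic 7 ℤ) = 0 →
          Polynomial.eval₂ (algebraMap ℚ ℂ) ρ Q = starRingEnd ℂ ρ) →
      ∀ c ∈ weilClassesField (AbelianVariety.kerComponent eN) sB (Polynomial.cyclotomic 7 ℤ) (2 * 6),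
        IsRationalClass c →
        IsOfHodgeType (AbelianVariety.kerComponent eN).dim (AbelianVariety.kerComponent eN).X (2 * 6) 6 6 c →
        c ∈ algebraicClasses (AbelianVariety.kerComponent eN).X 6 := by
  intro C 𝒥 σ _ _ _ _ s eN _ _ sB _ hmon hdeg h2 hirr hev hdim hre hQ c hc hrat hpq
  exact h _ sB (Polynomial.cyclotomic 7 ℤ) 6 6 hmon hdeg h2 hirr hev hdim hre hQ c hc hrat hpq

/-- **On-path lemma**: the Hodge conjecture implies R3 on Schoen's degree-`7` cyclic-Prym locus
(`HodgeConjecture → WeilClassesCMField →` the locus). -/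
theorem weilClassesCMField_cyclicPrymSeven_of_hodgeConjecture (h : _root_.HodgeConjecture) :
    ∀ (C : SchemeOver ℂ) (𝒥 : Jacobian C) (σ : C ⟶ C),
      IsSmoothProjective 1 C → 𝒥.J.dim = 43 →
      σ ≫ σ ≫ σ ≫ σ ≫ σ ≫ σ ≫ σ = 𝟙 C → (∀ P : ComplexPoints C, P ≫ σ ≠ P) →
    ∀ (s eN : 𝒥.J ⟶ 𝒥.J), s = 𝒥.pushforward 𝒥 σ →
      eN = 𝟙 𝒥.J + s + s ≫ s + s ≫ s ≫ s + s ≫ s ≫ s ≫ s + s ≫ s ≫ s ≫ s ≫ s +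
        s ≫ s ≫ s ≫ s ≫ s ≫ s →
    ∀ (sB : AbelianVariety.kerComponent eN ⟶ AbelianVariety.kerComponent eN),
      sB ≫ AbelianVariety.kerComponentι eN = AbelianVariety.kerComponentι eN ≫ s →
      (Polynomial.cyclotomic 7 ℤ).Monic → (Polynomial.cyclotomic 7 ℤ).natDegree = 6 → 2 < 6 →
      Irreducible ((Polynomial.cyclotomic 7 ℤ).map (Int.castRingHom ℚ)) →
      Polynomial.eval₂ (Int.castRingHom (CategoryTheory.End (AbelianVariety.kerComponent eN)))
        (sB : CategoryTheory.End (AbelianVariety.kerComponent eN)) (Polynomial.cyclotomic 7 ℤ) = 0 →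
      6 * (2 * 6) = 2 * (AbelianVariety.kerComponent eN).dim →
      (∀ ρ : ℂ, Polynomial.eval₂ (Int.castRingHom ℂ) ρ (Polynomial.cyclotomic 7 ℤ) = 0 →
        starRingEnd ℂ ρ ≠ ρ) →
      (∃ Q : Polynomial ℚ, ∀ ρ : ℂ, Polynomial.eval₂ (Int.castRingHom ℂ) ρ (Polynomial.cyclotomic 7 ℤ) = 0 →
          Polynomial.eval₂ (algebraMap ℚ ℂ) ρ Q = starRingEnd ℂ ρ) →
      ∀ c ∈ weilClassesField (AbelianVariety.kerComponent eN) sB (Polynomial.cyclotomic 7 ℤ) (2 * 6),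
        IsRationalClass c →
        IsOfHodgeType (AbelianVariety.kerComponent eN).dim (AbelianVariety.kerComponent eN).X (2 * 6) 6 6 c →
        c ∈ algebraicClasses (AbelianVariety.kerComponent eN).X 6 :=
  weilClassesCMField_cyclicPrymSeven_of_weilClassesCMField (weilClassesCMField_of_hodgeConjecture h)

end Summit.HodgeConjecture.HodgeConjecture.WeilTypeLadder

end
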